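import Summits.CriticalPhenomena.PercolationContinuityZ3.Theorems.Transplant.SkelNeg1ClosureA
import HarnessLib

/-!
# N1 (the {±1} node), the RE-ORDERED CLOSURE at the CHOICE level (NEG-SCOPE §B.19 (Q′-3); design owner p3-g11): the constants record
# `ConstsA` (= `Consts` + the corridor accuracy function `δC`), oriented choice functions over it, the four obligations — Geom UNCHANGED,
# Root (law-carrying) / Face = the old bodies GIVEN the handed-down facts `FlatR` / `FlatR + ChainFactF`, Reach :=
# `∃ nmax, Skel.ReachOblRHN G nmax … (κ.δC nmax)` (any corridor length) — and **`samePDropOfSkeletonNeg₁_of_choiceFnNOWA`**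

builds on p205010 (kernel theorem, internal audit signed; external expert review pending) through `samePDropOfSkeletonNeg₁_of_residuesNOWA`.
`SamePDropOfSkeletonNeg₁` stays OPEN; the interface of record (`ChoiceNO`, p282003) and the closure of record (`…_of_choiceFnNOW`, p286999)
are untouched — this is the ADDITIONAL closure top of NEG-SCOPE §B.19, for the lead's ruling.
Lane `prim-bschramm`, seat `prim-bschramm-p3` (gen 11; N1 design owner); helper file (`--supports stmt-CriticalPhenomena-4575`).

* `ConstsA` — `SkelConc.Consts` extended by `δC : ℕ → ℝ` with `0 < δC n ≤ 1`;
* `FlatR Lf κ` (the root table is flat on `[0, Lf K₀]`) and `ChainFactF Lf G Δ κ` (the face inner-chain fact: kits at `κ.δr 0`, length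
  `≤ Lf κ.K₀`, conclusion `1 − κ.δ₂²`) — the two facts the closure hands DOWN, indexed by the node₁ file's budget function `Lf`;
* `ChoiceFnNOA` — an oriented choice function of `κ : ConstsA` (values in the UNCHANGED structure `ChoiceNO κ.toConsts …`);
* `GeomHoldsNOFnA` — the old body read through `κ.toConsts`; `RootHoldsNOWFnA Lf` — the old body GIVEN `FlatR Lf κ`; `FaceHoldsRNOFnA Lf` — the
  old body GIVEN `FlatR Lf κ` and `ChainFactF Lf G Φ.Δ κ`; `ReachHoldsRHNOFnA` — the corridor obligation at ANY length with kits at `κ.δC nmax`;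
* `ChoiceFnNO.liftA` + `geomHoldsNOFnA_liftA / rootHoldsNOWFnA_liftA / faceHoldsRNOFnA_liftA` — a choice function of `Consts` lifts, and its
  three landed obligations transfer by one line (so Geom/(R)/(F) wrappers of record re-target IF the served choice function is a lift; a served
  function whose Step-I accuracy `δI` must also see `δC` is NOT a lift — then the three wrappers are re-instantiated, their proofs unchanged);
* **`samePDropOfSkeletonNeg₁_of_choiceFnNOWA`** — an oriented `ConstsA`-choice function meeting the four obligations gives the node.
[cite: KozmaNitzan2024, §4 Theorem 6 (pp. 25–31); §1 p. 2 (approach 1)] [this work]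
-/

noncomputable section

open MeasureTheory ProbabilityTheory
open scoped ENNReal Classical

namespace Summit.CriticalPhenomena.PercolationContinuityZ3.Theorems.Transplant

open Literature.Probability.Percolation Literature.Probability.LatticeModels SimpleGraph KNCells KNLevels
open Literature.Barriers.CriticalPhenomena (HasExponentialGrowth)

namespace PlanarSkeletonNeg

open SkelConc (Consts)

/-! ## §1 The constants with a corridor accuracy function -/

/-- **The constants the re-ordered closure fixes**: `K₀, δ (= δc), δ₂, δr` as in `SkelConc.Consts`, and the corridor kit accuracy `δC n`
for corridors of at most `n + 1` rounds. [this work] -/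
structure ConstsA extends Consts where
  /-- the corridor kit accuracy as a function of the corridor length bound -/
  δC : ℕ → ℝ
  hδC : ∀ n, 0 < δC n ∧ δC n ≤ 1

/-- **The root table is FLAT on `[0, Lf K₀]`** (a property of the constants the re-ordered closure constructs; handed to the Root and Face
dischargers as a hypothesis, indexed by the SAME budget function `Lf` the node₁ file gives the closure). [this work] -/
def FlatR (Lf : ℕ → ℕ) (κ : ConstsA) : Prop := ∀ n, n ≤ Lf κ.K₀ → κ.δr n = κ.δr 0

/-- **The FACE INNER-CHAIN FACT handed down by the re-ordered closure** (design owner's (3a) ruling): in every window graph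
`Skel.winGraph G c Rπ`, linked chains of `n + 1 ≤ Lf κ.K₀ + 1` target steps with kits at the flat root accuracy `κ.δr 0`, excess
`≤ κ.δr 0 / 2` and source at `1 − κ.δr 0` conclude at `1 − κ.δ₂²` — the `hchain` hypothesis of the (F) keystone
(`Skelφ.hkits_faceSteps_of_nums5`) verbatim in shape, so the (F) wrapper discharges it by THIS fact and `δkit ≤ κ.δr 0`, with no
`δUP` range. [this work] -/
def ChainFactF (Lf : ℕ → ℕ) {V : Type} [DecidableEq V] [Countable V] (G : SimpleGraph V) [G.LocallyFinite] (Δ : ℕ) (κ : ConstsA) : Prop :=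
  ∀ n, n ≤ Lf κ.K₀ → ∀ (q' : unitInterval), (q' : ℝ) < 1 →
    ∀ (c : V) (Rπ : ℕ) (Wg : Sym2 V → unitInterval) (s : Fin (n + 1) → KNLevels.TStep (Skel.winGraph G c Rπ))
      (T' : Fin (n + 1) → Finset V) (η : ℝ),
      (∀ i : Fin (n + 1), (s i).L.o = (s 0).L.o) →
      (∀ i : Fin n, T' (Fin.castSucc i) ⊆ (s i.succ).L.X 0) →
      (∀ i : Fin (n + 1), T' i ⊆ (s i).T) →
      (∀ i : Fin (n + 1), (s i).KitsAt Wg q' Δ (κ.δr 0)) →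
      η ≤ κ.δr 0 / 2 →
      (∀ i : Fin (n + 1), (prodBernoulli Wg).real (⋃ t ∈ (s i).T \ T' i, openConn (s 0).L.o t) ≤ η) →
      1 - κ.δr 0 < (prodBernoulli Wg).real (s 0).L.reachB →
        1 - κ.δ₂ ^ 2 < (prodBernoulli Wg).real (⋃ t ∈ T' (Fin.last n), openConn (s 0).L.o t)

variable {V : Type} [DecidableEq V] [Countable V] {G : SimpleGraph V} [G.LocallyFinite]

/-- **An oriented N1 choice function over `ConstsA`** (values in the unchanged `ChoiceNO`). [this work] -/
def ChoiceFnNOA : Type 1 :=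
  ∀ (κ : ConstsA) {V : Type} [DecidableEq V] [Countable V] (G : SimpleGraph V) [G.LocallyFinite] (Φ : PlanarSkeletonNeg G),
    ¬ HasExponentialGrowth G → ∀ (t : V), t ∈ Φ.types → Φ.types = {t} → ∀ (p : unitInterval), 0 < (p : ℝ) → (p : ℝ) < 1 →
      ∀ (hC : Φ.CylSubcritical p), ChoiceNO κ.toConsts Φ t p hC

/-- The geometric obligation of a `ConstsA`-choice function. [this work] -/
def GeomHoldsNOFnA (𝒞₀ : ChoiceFnNOA) : Prop :=
  ∀ (κ : ConstsA) {V : Type} [DecidableEq V] [Countable V] (G : SimpleGraph V) [G.LocallyFinite] (Φ : PlanarSkeletonNeg G)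
    (hg : ¬ HasExponentialGrowth G) (t : V) (ht : t ∈ Φ.types) (h1 : Φ.types = {t}) (p : unitInterval) (hp0 : 0 < (p : ℝ)) (hp1 : (p : ℝ) < 1)
    (hC : Φ.CylSubcritical p), (𝒞₀ κ G Φ hg t ht h1 p hp0 hp1 hC).GeomHoldsNO

/-- **The law-carrying root obligation of a `ConstsA`-choice function, GIVEN the flat root table on `[0, Lf K₀]`** (so a kit accuracy
`≤ κ.δr 0` serves root chains of every length `≤ Lf κ.K₀`: `Skel.RootOblTW` asks kits at `κ.δr N`, `= κ.δr 0`). [this work] -/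
def RootHoldsNOWFnA (Lf : ℕ → ℕ) (𝒞₀ : ChoiceFnNOA) : Prop :=
  ∀ (κ : ConstsA) {V : Type} [DecidableEq V] [Countable V] (G : SimpleGraph V) [G.LocallyFinite] (Φ : PlanarSkeletonNeg G)
    (hg : ¬ HasExponentialGrowth G) (t : V) (ht : t ∈ Φ.types) (h1 : Φ.types = {t}) (p : unitInterval) (hp0 : 0 < (p : ℝ)) (hp1 : (p : ℝ) < 1)
    (hC : Φ.CylSubcritical p), FlatR Lf κ → (𝒞₀ κ G Φ hg t ht h1 p hp0 hp1 hC).RootHoldsNOW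

/-- **The face obligation of a `ConstsA`-choice function, GIVEN the face inner-chain fact** (the discharger may use `ChainFactF`). [this work] -/
def FaceHoldsRNOFnA (Lf : ℕ → ℕ) (𝒞₀ : ChoiceFnNOA) : Prop :=
  ∀ (κ : ConstsA) {V : Type} [DecidableEq V] [Countable V] (G : SimpleGraph V) [G.LocallyFinite] (Φ : PlanarSkeletonNeg G)
    (hg : ¬ HasExponentialGrowth G) (t : V) (ht : t ∈ Φ.types) (h1 : Φ.types = {t}) (p : unitInterval) (hp0 : 0 < (p : ℝ)) (hp1 : (p : ℝ) < 1)
    (hC : Φ.CylSubcritical p), FlatR Lf κ → ChainFactF Lf G Φ.Δ κ → (𝒞₀ κ G Φ hg t ht h1 p hp0 hp1 hC).FaceHoldsRNO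

/-- **The corridor obligation of a `ConstsA`-choice function, ANY LENGTH**: at every `(O, q)` with the premises of step (B), for SOME `nmax`,
`Skel.ReachOblRHN G nmax` at kit accuracy `κ.δC nmax` (the (C) column picks its corridor length after `K₀`). [this work] -/
def ReachHoldsRHNOFnA (𝒞₀ : ChoiceFnNOA) : Prop :=
  ∀ (κ : ConstsA) {V : Type} [DecidableEq V] [Countable V] (G : SimpleGraph V) [G.LocallyFinite] (Φ : PlanarSkeletonNeg G)
    (hg : ¬ HasExponentialGrowth G) (t : V) (ht : t ∈ Φ.types) (h1 : Φ.types = {t}) (p : unitInterval) (hp0 : 0 < (p : ℝ)) (hp1 : (p : ℝ) < 1)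
    (hC : Φ.CylSubcritical p) (O : Skelφ.StepI.OutO V) (q : unitInterval), (𝒞₀ κ G Φ hg t ht h1 p hp0 hp1 hC).AtQO O q →
      ∃ nmax : ℕ, Skel.ReachOblRHN G nmax ((𝒞₀ κ G Φ hg t ht h1 p hp0 hp1 hC).scheme O q) ((𝒞₀ κ G Φ hg t ht h1 p hp0 hp1 hC).FD O q)
        Φ.Δ (κ.δC nmax)

/-! ## §2 Lifting a `Consts`-choice function; the three old obligations transfer -/

/-- A `Consts`-choice function read through `ConstsA.toConsts`. [this work] -/
def ChoiceFnNO.liftA (𝒞₀ : ChoiceFnNO) : ChoiceFnNOA :=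
  fun κ _ _ _ G _ Φ hg t ht h1 p hp0 hp1 hC => 𝒞₀ κ.toConsts G Φ hg t ht h1 p hp0 hp1 hC

/-- Geom transfers to the lift. [folklore] -/
theorem geomHoldsNOFnA_liftA {𝒞₀ : ChoiceFnNO} (h : GeomHoldsNOFn 𝒞₀) : GeomHoldsNOFnA (ChoiceFnNO.liftA 𝒞₀) :=
  fun κ _ _ _ G _ Φ hg t ht h1 p hp0 hp1 hC => h κ.toConsts G Φ hg t ht h1 p hp0 hp1 hC

/-- Root (law-carrying) transfers to the lift (the flatness hypothesis is not needed by an old-style discharger). [folklore] -/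
theorem rootHoldsNOWFnA_liftA (Lf : ℕ → ℕ) {𝒞₀ : ChoiceFnNO} (h : RootHoldsNOWFn 𝒞₀) : RootHoldsNOWFnA Lf (ChoiceFnNO.liftA 𝒞₀) :=
  fun κ _ _ _ G _ Φ hg t ht h1 p hp0 hp1 hC _ => h κ.toConsts G Φ hg t ht h1 p hp0 hp1 hC

/-- Face transfers to the lift (the two handed-down facts are not needed by an old-style discharger). [folklore] -/
theorem faceHoldsRNOFnA_liftA (Lf : ℕ → ℕ) {𝒞₀ : ChoiceFnNO} (h : FaceHoldsRNOFn 𝒞₀) : FaceHoldsRNOFnA Lf (ChoiceFnNO.liftA 𝒞₀) :=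
  fun κ _ _ _ G _ Φ hg t ht h1 p hp0 hp1 hC _ _ => h κ.toConsts G Φ hg t ht h1 p hp0 hp1 hC

/-- The old corridor obligation (length `≤ nmaxN`, accuracy `κ.δ`) implies the new one WHEN `κ.δ ≤ κ.δC Skel.nmaxN` (kits are monotone in the
accuracy) — recorded only to show the new obligation is not stronger in kind; the point of the new one is that `nmax` is free. [folklore] -/
theorem reachHoldsRHNOFnA_liftA_of_le {𝒞₀ : ChoiceFnNO} (h : ReachHoldsRHNOFn 𝒞₀) (κ : ConstsA) (hle : κ.δ ≤ κ.δC Skel.nmaxN)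
    {V : Type} [DecidableEq V] [Countable V] (G : SimpleGraph V) [G.LocallyFinite] (Φ : PlanarSkeletonNeg G)
    (hg : ¬ HasExponentialGrowth G) (t : V) (ht : t ∈ Φ.types) (h1 : Φ.types = {t}) (p : unitInterval) (hp0 : 0 < (p : ℝ)) (hp1 : (p : ℝ) < 1)
    (hC : Φ.CylSubcritical p) (O : Skelφ.StepI.OutO V) (q : unitInterval) (hat : (ChoiceFnNO.liftA 𝒞₀ κ G Φ hg t ht h1 p hp0 hp1 hC).AtQO O q) :
    ∃ nmax : ℕ, Skel.ReachOblRHN G nmax ((ChoiceFnNO.liftA 𝒞₀ κ G Φ hg t ht h1 p hp0 hp1 hC).scheme O q)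
      ((ChoiceFnNO.liftA 𝒞₀ κ G Φ hg t ht h1 p hp0 hp1 hC).FD O q) Φ.Δ (κ.δC Skel.nmaxN) := by
  refine ⟨Skel.nmaxN, ?_⟩
  intro hh e hrun hc hV du hdu
  obtain ⟨n, hn, Ω, s, T', η, ho, hlink, hsub, hkits, hη, hexc, hB0, hTn⟩ := h κ.toConsts G Φ hg t ht h1 p hp0 hp1 hC O q hat hh e hrun hc hV du hdu
  exact ⟨n, hn, Ω, s, T', η, ho, hlink, hsub, fun i => (hkits i).mono hle, hη.trans (by linarith), hexc, hB0, hTn⟩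

/-! ## §3 The node from a `ConstsA`-choice function -/

/-- **THE N1 PARTIAL CLOSURE, RE-ORDERED, oriented shared-choice form, root law-carrying, corridor of any length**: an oriented
`ConstsA`-choice function meeting the geometric, the law-carrying root, the face and the any-length corridor obligations gives
`SamePDropOfSkeletonNeg₁` (through `samePDropOfSkeletonNeg₁_of_residuesNOWA`). [cite: KozmaNitzan2024, §4 Theorem 6 (pp. 25–31); §1 p. 2]
[this work] -/
theorem samePDropOfSkeletonNeg₁_of_choiceFnNOWA (Lf : ℕ → ℕ) (𝒞₀ : ChoiceFnNOA) (hGm : GeomHoldsNOFnA 𝒞₀) (hR : RootHoldsNOWFnA Lf 𝒞₀)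
    (hF : FaceHoldsRNOFnA Lf 𝒞₀) (hRe : ReachHoldsRHNOFnA 𝒞₀) : SamePDropOfSkeletonNeg₁ := by
  refine samePDropOfSkeletonNeg₁_of_residuesNOWA Lf
    fun K₀ δ δ₂ δr δC hδ0 hδ1 hδ₂0 hδ₂1 hδr hδC hflat {V} _ _ G _ Φ hg t ht h1 p hp0 hp1 _ hC _ hCF => ?_
  set κ : ConstsA := ⟨⟨K₀, δ, δ₂, δr, hδ0, hδ1, hδ₂0, hδ₂1, hδr⟩, δC, hδC⟩ with hκ
  have hflat' : FlatR Lf κ := hflat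
  have hCF' : ChainFactF Lf G Φ.Δ κ := hCF
  set 𝒞 := 𝒞₀ κ G Φ hg t ht h1 p hp0 hp1 hC with h𝒞
  refine ⟨𝒞.δI, 𝒞.m₀, 𝒞.δI_pos, 𝒞.δI_lt_one, fun O hfacts => ?_⟩
  obtain ⟨hSz, hSMn⟩ := 𝒞.S_adm O hfacts
  refine ⟨𝒞.Sz O, 𝒞.SMn O, hSz, hSMn, fun q hq1 hq2 hin hCq => ?_⟩
  have hat : 𝒞.AtQO O q := ⟨hfacts, hq1, hq2, hin, hCq⟩
  obtain ⟨hroot, hK, hrun, hanch, hsep, hexit, hsteps, hlev⟩ := hGm κ G Φ hg t ht h1 p hp0 hp1 hC O q hat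
  obtain ⟨nmax, hreach⟩ := hRe κ G Φ hg t ht h1 p hp0 hp1 hC O q hat
  exact ⟨ℕ, 𝒞.Γ O q, 𝒞.FD O q, 𝒞.LD O q, hroot, hK, hrun, hanch, hsep, hexit, hsteps, hlev,
    hR κ G Φ hg t ht h1 p hp0 hp1 hC hflat' O q hat, hF κ G Φ hg t ht h1 p hp0 hp1 hC hflat' hCF' O q hat, nmax, hreach⟩

end PlanarSkeletonNeg

end Summit.CriticalPhenomena.PercolationContinuityZ3.Theorems.Transplant

end
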